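import Summits.QuantumFields.YangMills.Theorems.MirrorModularBoostsHypercubicLimitPeelReflHermRP
import HarnessLib

/-!
# Crux `HypercubicLimit` (stmt-QuantumFields-16154), line `peel-and-disseminate`: (R3b) equicontinuity of the RP-adapted family and moving test functions

Support file (c3 seat, `--supports stmt-QuantumFields-16154`, registered sub-goal `norm_rpFam_le_eventually`)
for the registered piece (R3b) `stub_decayOfSlabClustering` of the reflection leg (R) of the line (main file
`MirrorModularBoostsHypercubicLimitPeelDecayOfSlabClustering.lean`).  The decay of the connected OS form of the
one-field limit is read off the lattice along test functions that MOVE with the level `k` (the lattice time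
translate `T_{2⌊t/2a_k⌋ a_k e₀} F → T_{t e₀} F` in `𝒮`); this file supplies the equicontinuity that makes the
RP-adapted family `rpFam` of the scheme (`MirrorModularBoostsHypercubicLimitPeelRpFamDefs.lean`) converge along
such moving sequences.

* `norm_rpFam_le_eventually` — **equicontinuity on `⁰𝒮ₙ`**: along a scheme with `a_k → 0`, eventually
  `0 < a_k`, `a_k⁻² ≤ L_k`, renormalisation `0 ≤ c_k ≤ a_k^{-Q}` and `SoftData`'s shifted uniform bound, there
  are `C, p` with `‖rpFam_k n F‖ ≤ C |F|_p` for all `F ∈ ⁰𝒮ₙ`, eventually in `k` UNIFORMLY in `F` (main term: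
  the shifted uniform bound at the unshifted points; difference: `rh_sameLimit` of
  `MirrorModularBoostsHypercubicLimitPeelReflSlice.lean`, `O(a_k)` and linear in two Schwartz norms; `n = 0, 1`
  by `rpFam_zero`, `rpFam_one`).
* `tendsto_apply_of_tendsto_offDiagonal` — moving test functions: `S_k F → T F` on `⁰𝒮ₙ` + equicontinuity +
  `F_k → F` in `𝒮` within `⁰𝒮ₙ` ⇒ `S_k F_k → T F` (the pattern of `translateMulti_apply_eq_of_tendsto` of
  `Literature/…/SchwingerLimitInheritance`).
* `isPositiveTimeMulti_translateMulti` — translating by a vector with non-negative time component keeps a test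
  function positive-time.

Refs: OsterwalderSchrader1975 §2 (`⁰𝒮`, the norms `|·|_m`); GlimmJaffe1987 §6.1; Hörmander I §7.1 (continuity
of translations on `𝒮`).
-/

set_option autoImplicit false
noncomputable section
open scoped SchwartzMap ENNReal
open MeasureTheory Filter Topology
open Literature.MathematicalPhysics.AQFT Literature.MathematicalPhysics.QuantumLattice
open Literature.MathematicalPhysics.QuantumFieldTheory
open Literature.Probability.LatticeModels (box Site)
open Summit.QuantumFields.YangMills.Cruxes.HypercubicLimit.ConditionalMeanTelescoping

namespace Summit.QuantumFields.YangMills.Cruxes.HypercubicLimit.PeelAndDisseminate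

-- adapted from `tendsto_rpTerm` (the same `rh_sameLimit` bookkeeping, kept as a bound instead of a limit)
/-- **Equicontinuity of the RP-adapted family of a scheme on `⁰𝒮ₙ`.**  Along a scheme with `a_k → 0`,
eventually `0 < a_k`, `a_k⁻² ≤ L_k`, renormalisation `0 ≤ c_k ≤ a_k^{-Q}` and the shifted uniform bound of
`SoftData`, there are `C, p` with `‖rpFam_k n F‖ ≤ C |F|_p` for every `F ∈ ⁰𝒮ₙ`, eventually in `k` (uniformly in
`F`; registered sub-goal of this file): the main term is bounded by the shifted uniform bound at the unshifted points, the difference to it by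
`rh_sameLimit` (`O(a_k)`, linear in two Schwartz norms of `F`). -/
theorem norm_rpFam_le_eventually :
    ∀ {G : Type} [Group G] [TopologicalSpace G] [IsTopologicalGroup G] [CompactSpace G] [MeasurableSpace G]
      [BorelSpace G] (r : LatticeRep G) (sch : SpeciesScheme (YMSpecies G)) {K : ℝ} {γ s Q : ℕ},
      0 ≤ K → Tendsto sch.a atTop (𝓝 0) → (∀ᶠ k in atTop, 0 < sch.a k) →
      (∀ᶠ k in atTop, (sch.a k)⁻¹ * (sch.a k)⁻¹ ≤ (sch.L k : ℝ)) →
      (∀ k, 0 ≤ sch.c r.curvature k) → (∀ k, sch.c r.curvature k ≤ ((sch.a k)⁻¹) ^ Q) →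
      (∀ n : ℕ, 2 ≤ n → ∀ᶠ k in atTop, ∀ (q : Fin n → Fin 4 × Fin 4), (∀ i, (q i).1 ≠ (q i).2) →
        ∀ (y : (Fin n → Site 4) → (Fin n → EuclideanSpace ℝ (Fin 4))),
          (∀ x l, ‖y x l - sch.a k • siteToE (x l)‖ ≤ 6 * sch.a k) →
            ∀ F : 𝓢((Fin n → EuclideanSpace ℝ (Fin 4)), ℂ), IsOffDiagonal F →
              (sch.c r.curvature k * sch.a k ^ 4) ^ n *
                  ‖∑ x ∈ Fintype.piFinset (fun _ : Fin n => box 4 (sch.L k)),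
                      ((planeWeight r (sch.β k) (sch.L k) q x : ℝ) : ℂ) * F (y x)‖ ≤
                (K * (n : ℝ) ^ γ) ^ n * schwartzNorm (s * n) F) →
      ∀ n : ℕ, ∃ (C : ℝ) (p : ℕ), ∀ᶠ k in atTop, ∀ F : 𝓢((Fin n → EuclideanSpace ℝ (Fin 4)), ℂ),
        IsOffDiagonal F →
          ‖rpFam r (sch.β k) (sch.L k) (sch.a k) (sch.c r.curvature k * sch.a k ^ 4) n F‖ ≤
            C * schwartzNorm p F := by
  intro G _ _ _ _ _ _ r sch K γ s Q hK ha0 hapos hL hc0 hcQ hU n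
  match n with
  | 0 =>
    refine ⟨1, 0, Eventually.of_forall fun k F _ => ?_⟩
    rw [rpFam_zero, one_mul]
    exact norm_le_schwartzNorm 0 F _
  | 1 =>
    refine ⟨0, 0, Eventually.of_forall fun k F _ => ?_⟩
    rw [rpFam_one, norm_zero, zero_mul]
  | (N + 2) =>
    set Z : ℝ := 81 * ∑' j : ℕ, (((j : ℝ) + 1) ^ 2)⁻¹ with hZ
    set Φ : ℝ := (K * ((N + 2 : ℕ) : ℝ) ^ γ) ^ (N + 2) with hΦ
    set R : ℝ := (2 * (r.N : ℝ)) ^ (N + 2) * 2 ^ (16 * (N + 2) + 2) * Z ^ (N + 2) *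
      4 ^ (10 * (N + 2) + 1 + Q * (N + 2)) with hR
    set P : ℕ := 10 * (N + 2) + 1 + Q * (N + 2) + (s * (N + 2) + 1) with hP
    have hΦ0 : 0 ≤ Φ := by positivity
    have hZ0 : 0 ≤ Z := by positivity
    have hR0 : 0 ≤ R := by positivity
    refine ⟨(Fintype.card (Fin (N + 2) → {q : Fin 4 × Fin 4 // q.1 < q.2}) : ℝ) * (5 * Φ + R), P, ?_⟩
    have ha2 : ∀ᶠ k in atTop, sch.a k ≤ 1 / 2 := ha0.eventually_le_const (by norm_num)
    filter_upwards [hapos, ha2, hL, hU (N + 2) (by omega)] with k hk1 hk2 hk3 hk4 F hF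
    have ha1 : sch.a k ≤ 1 := hk2.trans (by norm_num)
    set lam : ℝ := sch.c r.curvature k * sch.a k ^ 4 with hlam
    have hlam0 : 0 ≤ lam := mul_nonneg (hc0 k) (by positivity)
    have hlamQ : lam ^ (N + 2) * sch.a k ^ (Q * (N + 2)) ≤ 1 := by
      have h1 : lam ≤ ((sch.a k)⁻¹) ^ Q :=
        calc lam = sch.c r.curvature k * sch.a k ^ 4 := rfl
          _ ≤ sch.c r.curvature k * 1 := mul_le_mul_of_nonneg_left (pow_le_one₀ hk1.le ha1) (hc0 k)
          _ ≤ ((sch.a k)⁻¹) ^ Q := by rw [mul_one]; exact hcQ k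
      calc lam ^ (N + 2) * sch.a k ^ (Q * (N + 2)) ≤ (((sch.a k)⁻¹) ^ Q) ^ (N + 2) * sch.a k ^ (Q * (N + 2)) :=
            mul_le_mul_of_nonneg_right (pow_le_pow_left₀ hlam0 h1 _) (pow_nonneg hk1.le _)
        _ = 1 := by rw [← pow_mul, ← mul_pow, inv_mul_cancel₀ hk1.ne', one_pow]
    -- per orientation string
    have hq1 : ∀ q : Fin (N + 2) → {q : Fin 4 × Fin 4 // q.1 < q.2},
        ‖((lam ^ (N + 2) : ℝ) : ℂ) * ∑ x ∈ Fintype.piFinset (fun j => rpDom (sch.L k) (q j)),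
          ((planeWeight r (sch.β k) (sch.L k) (fun i => (q i).1) x : ℝ) : ℂ) *
            F (fun l => sch.a k • siteToE (x l) + rpShift (sch.a k) (q l))‖ ≤ (5 * Φ + R) * schwartzNorm P F := by
      intro q
      have hq : ∀ i, ((fun i => (q i).1) i).1 ≠ ((fun i => (q i).1) i).2 := fun i => ne_of_lt (q i).2
      -- the main term
      have hmain : lam ^ (N + 2) * ‖∑ x ∈ Fintype.piFinset (fun _ : Fin (N + 2) => box 4 (sch.L k)),
          ((planeWeight r (sch.β k) (sch.L k) (fun i => (q i).1) x : ℝ) : ℂ) *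
            F (fun l => sch.a k • siteToE (x l))‖ ≤ Φ * schwartzNorm (s * (N + 2)) F :=
        hk4 (fun i => (q i).1) hq (fun x l => sch.a k • siteToE (x l))
          (fun x l => by rw [sub_self, norm_zero]; positivity) F hF
      -- the difference
      have hdiff := rh_sameLimit (N + 2) (sch.L k) (s * (N + 2)) (Q * (N + 2)) (2 * r.N) (sch.a k) lam Φ
        (planeWeight r (sch.β k) (sch.L k) (fun i => (q i).1))
        (Fintype.piFinset (fun j => rpDom (sch.L k) (q j))) (fun l => rpShift (sch.a k) (q l)) F
        (by positivity) (abs_planeWeight_le_pow r _ _ _) hk1 hk2 hk3 hΦ0 hlam0 hlamQ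
        (rpDom_subset _ q) (fun x hx hxD => rpDom_far _ q x hx hxD) (fun l => norm_rpShift_le hk1.le (q l)) hF
        (fun y hy G' hG' => hk4 (fun i => (q i).1) hq y (fun x l => (hy x l).trans (by linarith)) G' hG')
      have hs1 : schwartzNorm (s * (N + 2)) F ≤ schwartzNorm P F := schwartzNorm_mono (by omega) F
      have hs2 : schwartzNorm (s * (N + 2) + 1) F ≤ schwartzNorm P F := schwartzNorm_mono (by omega) F
      have hs3 : schwartzNorm (10 * (N + 2) + 1 + Q * (N + 2)) F ≤ schwartzNorm P F :=
        schwartzNorm_mono (by omega) F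
      have hsP : 0 ≤ schwartzNorm P F := schwartzNorm_nonneg _ _
      rw [norm_mul, Complex.norm_real, Real.norm_of_nonneg (pow_nonneg hlam0 _)]
      calc lam ^ (N + 2) * ‖∑ x ∈ Fintype.piFinset (fun j => rpDom (sch.L k) (q j)),
            ((planeWeight r (sch.β k) (sch.L k) (fun i => (q i).1) x : ℝ) : ℂ) *
              F (fun l => sch.a k • siteToE (x l) + rpShift (sch.a k) (q l))‖
          ≤ lam ^ (N + 2) * ‖∑ x ∈ Fintype.piFinset (fun _ : Fin (N + 2) => box 4 (sch.L k)),
              ((planeWeight r (sch.β k) (sch.L k) (fun i => (q i).1) x : ℝ) : ℂ) *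
                F (fun l => sch.a k • siteToE (x l))‖ +
            lam ^ (N + 2) * ‖(∑ x ∈ Fintype.piFinset (fun j => rpDom (sch.L k) (q j)),
              ((planeWeight r (sch.β k) (sch.L k) (fun i => (q i).1) x : ℝ) : ℂ) *
                F (fun l => sch.a k • siteToE (x l) + rpShift (sch.a k) (q l))) -
              ∑ x ∈ Fintype.piFinset (fun _ : Fin (N + 2) => box 4 (sch.L k)),
                ((planeWeight r (sch.β k) (sch.L k) (fun i => (q i).1) x : ℝ) : ℂ) *
                  F (fun l => sch.a k • siteToE (x l))‖ := by
            rw [← mul_add]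
            exact mul_le_mul_of_nonneg_left (norm_le_norm_add_norm_sub' _ _) (pow_nonneg hlam0 _)
        _ ≤ Φ * schwartzNorm (s * (N + 2)) F + sch.a k * (4 * Φ * schwartzNorm (s * (N + 2) + 1) F +
              R * schwartzNorm (10 * (N + 2) + 1 + Q * (N + 2)) F) :=
            add_le_add hmain hdiff
        _ ≤ Φ * schwartzNorm P F + (4 * Φ * schwartzNorm P F + R * schwartzNorm P F) := by
            have hX0 : 0 ≤ 4 * Φ * schwartzNorm (s * (N + 2) + 1) F +
                R * schwartzNorm (10 * (N + 2) + 1 + Q * (N + 2)) F :=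
              add_nonneg (mul_nonneg (by positivity) (schwartzNorm_nonneg _ _))
                (mul_nonneg hR0 (schwartzNorm_nonneg _ _))
            refine add_le_add (mul_le_mul_of_nonneg_left hs1 hΦ0) ((mul_le_of_le_one_left hX0 ha1).trans ?_)
            exact add_le_add (mul_le_mul_of_nonneg_left hs2 (by positivity)) (mul_le_mul_of_nonneg_left hs3 hR0)
        _ = (5 * Φ + R) * schwartzNorm P F := by ring
    rw [rpFam_apply]
    refine (norm_sum_le _ _).trans ?_
    calc ∑ q : Fin (N + 2) → {q : Fin 4 × Fin 4 // q.1 < q.2},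
          ‖((lam ^ (N + 2) : ℝ) : ℂ) * ∑ x ∈ Fintype.piFinset (fun j => rpDom (sch.L k) (q j)),
            ((planeWeight r (sch.β k) (sch.L k) (fun i => (q i).1) x : ℝ) : ℂ) *
              F (fun l => sch.a k • siteToE (x l) + rpShift (sch.a k) (q l))‖
        ≤ ∑ _q : Fin (N + 2) → {q : Fin 4 × Fin 4 // q.1 < q.2}, (5 * Φ + R) * schwartzNorm P F :=
          Finset.sum_le_sum fun q _ => hq1 q
      _ = (Fintype.card (Fin (N + 2) → {q : Fin 4 × Fin 4 // q.1 < q.2}) : ℝ) * (5 * Φ + R) *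
            schwartzNorm P F := by
          rw [Finset.sum_const, Finset.card_univ, nsmul_eq_mul, mul_assoc]

-- adapted from `translateMulti_apply_eq_of_tendsto` (`Literature/…/SchwingerLimitInheritance`)
/-- **Moving test functions under an equicontinuous convergent sequence of distributions.**  If `S k F → T F`
on `⁰𝒮ₙ`, `‖S k F‖ ≤ C |F|_p` on `⁰𝒮ₙ` eventually (uniformly in `F`), and `F_k → F` in `𝒮` within `⁰𝒮ₙ`, then
`S k F_k → T F`. -/
theorem tendsto_apply_of_tendsto_offDiagonal {E' : Type*} [NormedAddCommGroup E'] [NormedSpace ℝ E'] {n : ℕ}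
    {S : ℕ → (𝓢((Fin n → E'), ℂ) →L[ℂ] ℂ)} {T : 𝓢((Fin n → E'), ℂ) →L[ℂ] ℂ}
    (hconv : ∀ F : 𝓢((Fin n → E'), ℂ), IsOffDiagonal F → Tendsto (fun k => S k F) atTop (𝓝 (T F)))
    {C : ℝ} {p : ℕ}
    (hb : ∀ᶠ k in atTop, ∀ F : 𝓢((Fin n → E'), ℂ), IsOffDiagonal F → ‖S k F‖ ≤ C * schwartzNorm p F)
    {Fk : ℕ → 𝓢((Fin n → E'), ℂ)} {F : 𝓢((Fin n → E'), ℂ)} (hFk : ∀ k, IsOffDiagonal (Fk k))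
    (hF : IsOffDiagonal F) (hlim : Tendsto Fk atTop (𝓝 F)) :
    Tendsto (fun k => S k (Fk k)) atTop (𝓝 (T F)) := by
  have hqc : Continuous fun G' : 𝓢((Fin n → E'), ℂ) => schwartzNorm p G' :=
    Seminorm.continuous_finsetSup (s := Finset.Iic (p, p)) fun i _ =>
      (schwartz_withSeminorms ℂ (Fin n → E') ℂ).continuous_seminorm i
  have h1 : Tendsto (fun k => Fk k - F) atTop (𝓝 0) := by
    simpa using hlim.sub (tendsto_const_nhds (x := F))
  have hN : Tendsto (fun k => schwartzNorm p (Fk k - F)) atTop (𝓝 0) := by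
    have h2 := (hqc.tendsto 0).comp h1
    rwa [show schwartzNorm p (0 : 𝓢((Fin n → E'), ℂ)) = 0 from map_zero _] at h2
  have h3 : Tendsto (fun k => S k (Fk k - F)) atTop (𝓝 0) := by
    refine squeeze_zero_norm' (hb.mono fun k hk => hk _ ((hFk k).sub hF)) ?_
    simpa using hN.const_mul C
  have h4 := h3.add (hconv F hF)
  rw [zero_add] at h4
  exact h4.congr fun k => by simp only [map_sub, sub_add_cancel]

/-- Translating a positive-time test function by a vector with non-negative time component keeps it positive-time. -/
theorem isPositiveTimeMulti_translateMulti {n : ℕ} {F : 𝓢((Fin n → EuclideanSpace ℝ (Fin 4)), ℂ)}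
    (hF : IsPositiveTimeMulti F) {v : EuclideanSpace ℝ (Fin 4)} (hv : 0 ≤ v 0) :
    IsPositiveTimeMulti (translateMulti v F) := by
  intro x hx i
  have h := hF (OSReconstructionNoE1.tsupport_translateMulti_subset v F hx) i
  have h' : 0 < x i 0 - v 0 := h
  linarith

end Summit.QuantumFields.YangMills.Cruxes.HypercubicLimit.PeelAndDisseminate

end
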